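import Summits.BirchSwinnertonDyer.BirchSwinnertonDyer.Theorems.PrintX9HeegnerRankOnePair
import HarnessLib

/-!
# Class X9, the HEEGNER ROAD at the level of the LEAF `BSDpOnClassX9` (rung K6): the sister route's
# typed rank-`0` engine `IntegralMainConjectureOnClassX9` + PUBLISHED named facts ⇒ the leaf, WITHOUT
# the Schneider rider, modulo ONE named residual (the Tamagawa-divisible rank-one pairs)
# (cell `bsd-print-x9`, prover seat p4; companion of `PrintX9HeegnerRankOne{,Pair}.lean`, `PrintX9HeegnerIMCLink.lean`)

HONEST FRAMING (cell `run/shared/lean/pub/bsd-print-x9/`, D-0131 print tier; verbatim from the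
charter): a leaf counts only when its class theorem is in the kernel BY NAME, flag-free; Literature
named facts are statement-only with cite tags; every imported theorem carries its printed hypotheses
verbatim; a stall becomes a NAMED residual crux. THEOREMS ONLY (no definition, no named fact, no
`sorry`). This file does NOT close `BSDpOnClassX9`: it is a CONDITIONAL BRIDGE (route support,
crux-record currency) whose open inputs are named below, binder by binder.

## What this file records

The sister route `SmallImageMuTransfer` (ledger 19629–19633) reaches the leaf by
`bsdpOnClassX9_of_integralMainConjectureOnClassX9` (Theorems/Rank1ResidualX9TwistCriterion.lean): the
typed rank-`0` engine `IntegralMainConjectureOnClassX9` (= `MuTransfer ∧ AnalyticMuZeroX9` by the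
kernel bridges of that route) + PUBLISHED binders + the SCHNEIDER certificate C3 at every rank-one X9
pair (`hC3`: the cyclotomic rank-one engine, Perrin-Riou–Schneider; crux SchneiderX9RankOne,
stmt-19631, a NAMED CONJECTURE). This file replaces `hC3` by the HEEGNER ROAD of
`PrintX9HeegnerRankOne{,Pair}.lean` / `PrintX9HeegnerIMCLink.lean` — Burungale–Castella–Skinner's
printed route to Cor. 1.3.1 (`r = 1`) re-run without (sur): Gross–Zagier + Kolyvagin's bound under
irreducibility (Matar–Nekovář 2019 Thm. 0.3 + §0.11) + the anticyclotomic control theorem (JSW 2017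
Thm. 3.3.1, hypothesis (irred_𝒦) from Matar–Nekovář Prop. 5.26 (2)) + (IMC≥∘BDP)ᵍ (BCS 2025 Thm. 1.2.4
(a) + Prop. 4.2.2 ∘ CGLS 2022 Thm. 5.1.3) + the rank-`0` engine AT THE TWIST (class X9 is
twist-closed). The leaf then follows from:

* PUBLISHED named facts (binders `hGZ hKo hMN h526 h124a h331 hGr hGZK hmodL hmodP hnf hHL hMaz hNS
  h5`; flags travelling with them, for the referee: `MN19-0.11-composite` /
  `Kolyvagin1990-Cor13-primary-unread` on `hMN`, `BCS25-124a+422-mu-composite` / `BCS25-IMC-equiv@BSTW`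
  on `h124a`);
* the K6 typed rank-`0` engine `hIMC : IntegralMainConjectureOnClassX9` (OPEN: the sister route's
  cruxes MuTransfer, kernel-checked modulo Kato's package F1, ∧ AnalyticMuZeroX9, Greenberg's
  conjecture on the class; or any other road to it);
* `hTam` — THE NAMED RESIDUAL of the road: the rank-one X9 pairs at which `p` divides a Tamagawa
  number (`p ∣ ∏_ℓ c_ℓ(E)`), where STEP L and Kolyvagin's STEP U do not meet (in print reconciled only
  by Jetchev–Skinner–Wan's Shimura-curve parametrisation under (sst), by W. Zhang's refined Kolyvagin
  conjecture — BCGS 2026 Thm. 2 / Castella et al. 2026 Thm. 3, both under (sur) —, or by BSTW 2024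
  Thm. 11.8 (b) under (im); per pair the tree's Jetchev–Cha certificates
  `bsdp_of_classX9_of_jetchevChaCertificate` serve).

NO `p`-adic height / Schneider hypothesis. Rank `0`: the engine `hIMC` directly (CGLS 2022 Thm.
5.1.4's valuation chain, as in the sister bridge). Nothing is booked; no label moves; currency:
crux-record.

References: [BurungaleCastellaSkinner2025] Thm. 1.2.4 (a), Prop. 4.2.2, Cor. 1.3.1 (proof, p. 4);
[MatarNekovar2019] Thm. 0.3, §0.11, Prop. 5.26 (2); [JetchevSkinnerWan2017] Thm. 3.3.1, §7.4;
[CastellaGrossiLeeSkinner2022] Thm. 5.1.3, Thm. 5.1.4; [GreenbergLNM1716] Thm. 4.1; [Hsieh2014] Thm.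
B; [Miller2011LMS] Def. 1.1; the sister route file `Theses/SmallImageMuTransfer.lean` (19629–19633).
-/

set_option linter.dupNamespace false
set_option autoImplicit false

noncomputable section

open scoped Classical MatrixGroups ModularForm

open CongruenceSubgroup WeierstrassCurve NumberField IsDedekindDomain
  Literature.NumberTheory.EllipticCurves Literature.NumberTheory.EllipticCurves.ModularForms
  Literature.NumberTheory.EllipticCurves.BurungaleCastellaSkinner2025
  Literature.NumberTheory.EllipticCurves.JetchevSkinnerWan2017
  Summit.BirchSwinnertonDyer.BirchSwinnertonDyer.Theorems.Rank1ResidualX1Defs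
  Summit.BirchSwinnertonDyer.Rank1Residual

open Literature.NumberTheory.EllipticCurves.Rank1Residual (GoodOrd Irr Surj BigIm
  norm_periodRatio_eq_one pPart_of_bsdp)

namespace Summit.BirchSwinnertonDyer.BirchSwinnertonDyer.Rank1Residual

/-! ### §6 Both analytic ranks at an X9 pair, from the K6 typed rank-`0` engine and PUBLISHED facts -/

/-- **`BSD(E,p)` at an X9 pair of analytic rank `≤ 1` with `p ∤ ∏_ℓ c_ℓ(E)` in rank one — the
rank-`0` engine `IntegralMainConjectureOnClassX9` (K6 typed input) + PUBLISHED named facts, nothing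
else.** Rank `0`: the engine at the pair, read in Mazur's shape
(`mazurMainConjecture_of_integralMainConjectureOnClassX9`), then CGLS 2022 Thm. 5.1.4's chain
(`bsdp_of_mazurMainConjecture_of_analyticRank_eq_zero`: Greenberg 4.1 `hGr`, modularity `hmodP`, GZK).
Rank `1`: `X9.bsdp_rankOne_of_thm331_of_thm124a_of_x9IntegralMainConjecture` (the engine at the TWIST;
Gross–Zagier, Kolyvagin, Matar–Nekovář 0.3/5.26 (2), JSW 3.3.1, BCS 1.2.4 (a) + 4.2.2 ∘ CGLS 5.1.3,
Hoffstein–Luo, Mazur's Manin constant, the period unit). NO Schneider certificate, NO (im), NO (sur).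
[cite: BurungaleCastellaSkinner2025, Cor. 1.3.1 and its proof (p. 4)] [cite: CastellaGrossiLeeSkinner2022, Thm. 5.1.4 (proof)]
[cite: JetchevSkinnerWan2017, Thm. 3.3.1] [cite: MatarNekovar2019, Thm. 0.3, §0.11, Prop. 5.26 (2)]
[cite: Miller2011LMS, Def. 1.1] -/
theorem X9.bsdp_of_x9IntegralMainConjecture_of_heegnerRoad
    -- published inputs (named facts of the tree)
    (hGZ : ∀ (N : ℕ) [NeZero N] (W : WeierstrassCurve ℚ) (K : Type) [Field K] [NumberField K],
      gross_zagier N W K)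
    (hKo : ∀ (N : ℕ) [NeZero N] (W : WeierstrassCurve ℚ) (K : Type) [Field K] [NumberField K],
      kolyvagin N W K)
    (hMN : ∀ (N : ℕ) [NeZero N] (W : WeierstrassCurve ℚ) (K : Type) [Field K] [NumberField K],
      MatarNekovar2019.thm03_padicValNat_card_sha_le_of_irreducible N W K)
    (h526 : MatarNekovar2019.prop526_hasIrreducibleModPGaloisRep_baseChange)
    (h124a : thm124a_prop422_thm513_generator_constantCoeff)
    (h331 : thm331_anticyclotomicControl)
    (hGr : greenberg_charValue_rankZero) (hGZK : rank_eq_analyticRank_of_analyticRank_le_one)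
    (hmodL : hasEntireLFunction_rat) (hmodP : nonempty_modularParametrizationData)
    (hnf : exists_isNewformOf) (hHL : HoffsteinLuo1997_exists_twist_L_one_ne_zero)
    (hMaz : mazur_not_dvd_maninConstant_of_odd) (hNS : integral_neronScaling_of_isGloballyMinimal)
    (h5 : realPeriodRat_eq_unit_mul_plusPeriod)
    -- the pair
    (W : WeierstrassCurve ℚ) [W.IsElliptic] [W.IsGloballyMinimal] (p : ℕ) [Fact p.Prime]
    (hX9 : ClassX9 W p) (hr : W.analyticRank ≤ 1)
    (htam0 : W.analyticRank = 1 → ¬ p ∣ W.tamagawaProduct)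
    -- the K6 typed rank-`0` engine
    (hIMC : IntegralMainConjectureOnClassX9) : BSDp W p := by
  obtain ⟨-, hp5, hgood, hord, -, -⟩ := id hX9
  rcases Nat.lt_or_ge W.analyticRank 1 with h0 | h1
  · -- analytic rank 0: the engine at the pair
    exact bsdp_of_mazurMainConjecture_of_analyticRank_eq_zero hGr hmodP hGZK (by omega) ⟨hgood, hord⟩
      (by omega) (mazurMainConjecture_of_integralMainConjectureOnClassX9 h5 hIMC hX9)
  · -- analytic rank 1: the Heegner road
    have hr1 : W.analyticRank = 1 := le_antisymm hr h1
    exact X9.bsdp_rankOne_of_thm331_of_thm124a_of_x9IntegralMainConjecture hGZ hKo hMN h526 h124a h331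
      hGr hGZK hmodL hmodP hnf hHL hMaz hNS h5 W p hX9 hr1 (htam0 hr1) hIMC

/-! ### §7 The LEAF from the K6 typed rank-`0` engine by the Heegner road: Schneider-free, ONE named residual -/

/-- **`BSDpOnClassX9` (the rung-K6 leaf, print shape `PPartBSD`) FROM the typed rank-`0` engine
`IntegralMainConjectureOnClassX9` BY THE HEEGNER ROAD — the Schneider-free twin of
`bsdpOnClassX9_of_integralMainConjectureOnClassX9`.** PUBLISHED binders: Gross–Zagier (`hGZ`),
Kolyvagin 1990 Thm. A (`hKo`), Matar–Nekovář 2019 Thm. 0.3 + §0.11 (`hMN`, Kolyvagin's bound under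
irreducibility) and Prop. 5.26 (2) (`h526`, (irr_ℚ) ⇒ (irr_K)), Burungale–Castella–Skinner 2025 Thm.
1.2.4 (a) + Prop. 4.2.2 ∘ CGLS 2022 Thm. 5.1.3 (`h124a`), Jetchev–Skinner–Wan 2017 Thm. 3.3.1
(`h331`), Greenberg LNM 1716 Thm. 4.1 (`hGr`), GZK (`hGZK`), modularity (`hmodL`, `hmodP`, `hnf`),
Hoffstein–Luo 1997 (`hHL`), Mazur 1978 Cor. 4.1 (`hMaz`) with the Néron mapping property (`hNS`), the
period unit (`h5`). TYPED input: the K6 rank-`0` engine `hIMC` (OPEN: the sister route's cruxes).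
NAMED RESIDUAL `hTam`: the rank-one X9 pairs with `p ∣ ∏_ℓ c_ℓ(E)` (the leaf's print shape there,
`PPartBSD W p`, as a hypothesis). CONCLUSION: the leaf `BSDpOnClassX9`. NO Schneider / `p`-adic height
input: compared with the sister bridge, the conjecture-grade rider C3 (crux SchneiderX9RankOne,
stmt-19631) is REPLACED by published facts and the Tamagawa residual. Conversion to the print shape by
`pPart_of_bsdp` / `pPartBSD_iff_pPart`. Nothing is booked: `hIMC` is open.
[cite: BurungaleCastellaSkinner2025, Cor. 1.3.1 and its proof (p. 4); Thm. 1.2.4 (a); Prop. 4.2.2]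
[cite: MatarNekovar2019, Thm. 0.3, §0.11, Prop. 5.26 (2)] [cite: JetchevSkinnerWan2017, Thm. 3.3.1, §7.4.1]
[cite: GreenbergLNM1716, Thm. 4.1 (p. 102)] [cite: Miller2011LMS, §1 and Def. 1.1] -/
theorem bsdpOnClassX9_of_integralMainConjectureOnClassX9_of_heegnerRoad
    -- published inputs (named facts of the tree)
    (hGZ : ∀ (N : ℕ) [NeZero N] (W : WeierstrassCurve ℚ) (K : Type) [Field K] [NumberField K],
      gross_zagier N W K)
    (hKo : ∀ (N : ℕ) [NeZero N] (W : WeierstrassCurve ℚ) (K : Type) [Field K] [NumberField K],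
      kolyvagin N W K)
    (hMN : ∀ (N : ℕ) [NeZero N] (W : WeierstrassCurve ℚ) (K : Type) [Field K] [NumberField K],
      MatarNekovar2019.thm03_padicValNat_card_sha_le_of_irreducible N W K)
    (h526 : MatarNekovar2019.prop526_hasIrreducibleModPGaloisRep_baseChange)
    (h124a : thm124a_prop422_thm513_generator_constantCoeff)
    (h331 : thm331_anticyclotomicControl)
    (hGr : greenberg_charValue_rankZero) (hGZK : rank_eq_analyticRank_of_analyticRank_le_one)
    (hmodL : hasEntireLFunction_rat) (hmodP : nonempty_modularParametrizationData)
    (hnf : exists_isNewformOf) (hHL : HoffsteinLuo1997_exists_twist_L_one_ne_zero)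
    (hMaz : mazur_not_dvd_maninConstant_of_odd) (hNS : integral_neronScaling_of_isGloballyMinimal)
    (h5 : realPeriodRat_eq_unit_mul_plusPeriod)
    -- the K6 typed rank-`0` engine
    (hIMC : IntegralMainConjectureOnClassX9)
    -- THE NAMED RESIDUAL of the road: rank one, `p` divides a Tamagawa number
    (hTam : ∀ (W : WeierstrassCurve ℚ) [W.IsElliptic] [W.IsGloballyMinimal] (p : ℕ) [Fact p.Prime],
      ClassX9 W p → W.analyticRank = 1 → p ∣ W.tamagawaProduct → Finite W.sha → PPartBSD W p) :
    BSDpOnClassX9 := by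
  intro W _ _ p _ hran hX9 hfin
  by_cases hres : W.analyticRank = 1 ∧ p ∣ W.tamagawaProduct
  · exact hTam W p hX9 hres.1 hres.2 hfin
  · have htam0 : W.analyticRank = 1 → ¬ p ∣ W.tamagawaProduct := fun hr1 hdvd ↦ hres ⟨hr1, hdvd⟩
    have hbsdp : BSDp W p :=
      X9.bsdp_of_x9IntegralMainConjecture_of_heegnerRoad hGZ hKo hMN h526 h124a h331 hGr hGZK hmodL
        hmodP hnf hHL hMaz hNS h5 W p hX9 hran htam0 hIMC
    exact (pPartBSD_iff_pPart W p).mpr (pPart_of_bsdp hmodL hGZK W p hran hbsdp)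

/-- **The same with the rank-`0` engine supplied by the sister route's two cruxes** (`KatoMuTransfer` =
Kato `μ`-transfer without `τ`, kernel-checked modulo Kato's package F1 — route decl `MuTransfer`,
stmt-19629; `AnalyticMuZeroOnClassX9` = Greenberg's analytic `μ = 0` on the class — route decl
`AnalyticMuZeroX9`, stmt-19630) through the landed kernel bridge
`integralMainConjectureOnClassX9_of_katoMuTransfer` (Rank1ResidualX9MuTransfer.lean) and BCS 2025 Thm.
1.1.2 (a) (`hBCS`): the route's leaf with its THIRD crux `SchneiderX9RankOne` (stmt-19631) REPLACED by
published facts + the Tamagawa residual `hTam`.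
[cite: BurungaleCastellaSkinner2025, Thm. 1.1.2 (a), Cor. 1.3.1] [cite: Kato2004Asterisque, Thm. 12.5, 17.4]
[cite: GreenbergLNM1716, Conj. 1.11, Thm. 4.1] -/
theorem bsdpOnClassX9_of_katoMuTransfer_of_heegnerRoad
    (hGZ : ∀ (N : ℕ) [NeZero N] (W : WeierstrassCurve ℚ) (K : Type) [Field K] [NumberField K],
      gross_zagier N W K)
    (hKo : ∀ (N : ℕ) [NeZero N] (W : WeierstrassCurve ℚ) (K : Type) [Field K] [NumberField K],
      kolyvagin N W K)
    (hMN : ∀ (N : ℕ) [NeZero N] (W : WeierstrassCurve ℚ) (K : Type) [Field K] [NumberField K],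
      MatarNekovar2019.thm03_padicValNat_card_sha_le_of_irreducible N W K)
    (h526 : MatarNekovar2019.prop526_hasIrreducibleModPGaloisRep_baseChange)
    (h124a : thm124a_prop422_thm513_generator_constantCoeff)
    (h331 : thm331_anticyclotomicControl)
    (hBCS : burungale_castella_skinner_charIdeal_eq_padicLFunction)
    (hGr : greenberg_charValue_rankZero) (hGZK : rank_eq_analyticRank_of_analyticRank_le_one)
    (hmodL : hasEntireLFunction_rat) (hmodP : nonempty_modularParametrizationData)
    (hnf : exists_isNewformOf) (hHL : HoffsteinLuo1997_exists_twist_L_one_ne_zero)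
    (hMaz : mazur_not_dvd_maninConstant_of_odd) (hNS : integral_neronScaling_of_isGloballyMinimal)
    (h5 : realPeriodRat_eq_unit_mul_plusPeriod)
    -- the sister route's two cruxes
    (h1 : KatoMuTransfer) (h2 : AnalyticMuZeroOnClassX9)
    -- the named residual, as above
    (hTam : ∀ (W : WeierstrassCurve ℚ) [W.IsElliptic] [W.IsGloballyMinimal] (p : ℕ) [Fact p.Prime],
      ClassX9 W p → W.analyticRank = 1 → p ∣ W.tamagawaProduct → Finite W.sha → PPartBSD W p) :
    BSDpOnClassX9 :=
  bsdpOnClassX9_of_integralMainConjectureOnClassX9_of_heegnerRoad hGZ hKo hMN h526 h124a h331 hGr hGZK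
    hmodL hmodP hnf hHL hMaz hNS h5 (integralMainConjectureOnClassX9_of_katoMuTransfer hBCS h1 h2) hTam

/-- **The rank-one HALF of the leaf is Schneider-free and certificate-free off the Tamagawa line**:
for every X9 pair of analytic rank `≤ 1` with `p ∤ ∏_ℓ c_ℓ(E)`, the print shape `PPartBSD W p` from the
published facts and the K6 typed rank-`0` engine — the statement the planner can file as the
Heegner-road assembly (`IntegralMainConjectureOnClassX9 → (∀ X9 pairs, p ∤ Tam → PPartBSD)`), the
Tamagawa-divisible rank-one pairs being the complementary named residual.
[cite: BurungaleCastellaSkinner2025, Cor. 1.3.1 and its proof (p. 4)] [cite: Miller2011LMS, §1 and Def. 1.1] -/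
theorem pPartBSD_of_classX9_of_not_dvd_tamagawa_of_integralMainConjectureOnClassX9
    (hGZ : ∀ (N : ℕ) [NeZero N] (W : WeierstrassCurve ℚ) (K : Type) [Field K] [NumberField K],
      gross_zagier N W K)
    (hKo : ∀ (N : ℕ) [NeZero N] (W : WeierstrassCurve ℚ) (K : Type) [Field K] [NumberField K],
      kolyvagin N W K)
    (hMN : ∀ (N : ℕ) [NeZero N] (W : WeierstrassCurve ℚ) (K : Type) [Field K] [NumberField K],
      MatarNekovar2019.thm03_padicValNat_card_sha_le_of_irreducible N W K)
    (h526 : MatarNekovar2019.prop526_hasIrreducibleModPGaloisRep_baseChange)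
    (h124a : thm124a_prop422_thm513_generator_constantCoeff)
    (h331 : thm331_anticyclotomicControl)
    (hGr : greenberg_charValue_rankZero) (hGZK : rank_eq_analyticRank_of_analyticRank_le_one)
    (hmodL : hasEntireLFunction_rat) (hmodP : nonempty_modularParametrizationData)
    (hnf : exists_isNewformOf) (hHL : HoffsteinLuo1997_exists_twist_L_one_ne_zero)
    (hMaz : mazur_not_dvd_maninConstant_of_odd) (hNS : integral_neronScaling_of_isGloballyMinimal)
    (h5 : realPeriodRat_eq_unit_mul_plusPeriod)
    (hIMC : IntegralMainConjectureOnClassX9)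
    (W : WeierstrassCurve ℚ) [W.IsElliptic] [W.IsGloballyMinimal] (p : ℕ) [Fact p.Prime]
    (hran : W.analyticRank ≤ 1) (hX9 : ClassX9 W p) (htam0 : ¬ p ∣ W.tamagawaProduct) :
    PPartBSD W p :=
  (pPartBSD_iff_pPart W p).mpr (pPart_of_bsdp hmodL hGZK W p hran
    (X9.bsdp_of_x9IntegralMainConjecture_of_heegnerRoad hGZ hKo hMN h526 h124a h331 hGr hGZK hmodL
      hmodP hnf hHL hMaz hNS h5 W p hX9 hran (fun _ ↦ htam0) hIMC))

end Summit.BirchSwinnertonDyer.BirchSwinnertonDyer.Rank1Residual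

end
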